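import Mathlib
import Summits.MatrixMultiplication.MatrixMultiplication.Theses.AutomaticSTPPDesigns
import Summits.MatrixMultiplication.MatrixMultiplication.Theses.GroupTheoreticSTPP
import Summits.MatrixMultiplication.MatrixMultiplication.Theorems.AutomaticSTPPDesignsAutomaticPackingThesisNormalForm

/-!
# `AutomaticPackingThesis` implies the abelian STPP thesis `CThesis`

Route `MatrixMultiplication/AutomaticSTPPDesigns`, crux `stmt-MatrixMultiplication-7356`
(`AutomaticPackingThesis`), line `Sketch`, lead c3. Support file (`--supports`): it does not close
the crux; it proves the registered stub `stub_cruxGivesCThesis` of the skeleton.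

By the normal form of the crux (`cyclicBeat_of_automaticPackingThesis`, tree file
`AutomaticSTPPDesignsAutomaticPackingThesisNormalForm`), a witness of `AutomaticPackingThesis` read
at exponent `τ := (2 + ε)/3 > 2/3` is a finite STPP design `(Aᵢ, Bᵢ, Cᵢ)_{i < n}` in the finite
cyclic group `ℤ/(p^K)` with `p^K < ∑ᵢ (|Aᵢ||Bᵢ||Cᵢ|)^((2+ε)/3)`. Since `|ℤ/(p^K)| = p^K`
(`ZMod.card`) and `IsSTPP` unfolds (`isSTPP_iff`, by `Iff.rfl`) to the simultaneous triple product
property inlined in `CThesis` (route `GroupTheoreticSTPP`, stmt-MatrixMultiplication-0593: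
Cohn–Kleinberg–Szegedy–Umans 2005, Def. 5.1 / Thm. 5.5), this is a witness of `CThesis` at `ε`:

* `cThesis_of_automaticPackingThesis` — `AutomaticPackingThesis → CThesis`;
* `stub_cruxGivesCThesis` — the registered stub of the skeleton, verbatim;
* `not_automaticPackingThesis_of_cAbelianObstructionNeg` — hence the route's effective negative
  `CAbelianObstructionNeg` (stmt-MatrixMultiplication-0596: a uniform `ε > 0` at which NO abelian
  STPP family beats its host) refutes the crux.

## References
* H. Cohn, R. Kleinberg, B. Szegedy, C. Umans, *Group-theoretic algorithms for matrix
  multiplication*, FOCS 2005, arXiv:math/0511460: Def. 5.1, Thm. 5.5.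
-/

-- single-conjunct summit: the mandated namespace repeats `MatrixMultiplication`.
set_option linter.dupNamespace false

noncomputable section

namespace Summit.MatrixMultiplication.MatrixMultiplication.Theorems

namespace AutomaticPackingThesis

open Finset Literature.Combinatorics.Additive Literature.Computability.AlgebraicComplexity
open Summit.MatrixMultiplication.MatrixMultiplication.Theses.AutomaticSTPPDesigns

/-- **The crux implies the abelian STPP thesis.** For every `ε > 0`, a witness of
`AutomaticPackingThesis` gives (via the normal form `cyclicBeat_of_automaticPackingThesis` at
`τ = (2+ε)/3 > 2/3`) a finite STPP family in the finite abelian group `ℤ/(p^K)` with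
`|ℤ/(p^K)| = p^K < ∑ᵢ (|Aᵢ||Bᵢ||Cᵢ|)^((2+ε)/3)`, i.e. a witness of `CThesis` at `ε`.
[cite: CohnKleinbergSzegedyUmans2005, Def. 5.1] -/
theorem cThesis_of_automaticPackingThesis (h : AutomaticPackingThesis) :
    Summit.MatrixMultiplication.MatrixMultiplication.Theses.GroupTheoreticSTPP.CThesis := by
  intro ε hε
  have hτ : (2 : ℝ) / 3 < (2 + ε) / 3 := by linarith
  obtain ⟨p, K, n, hp, A, B, C, hS, hbeat⟩ := cyclicBeat_of_automaticPackingThesis h _ hτ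
  haveI : NeZero (p ^ K) := ⟨pow_ne_zero _ (by omega)⟩
  refine ⟨ZMod (p ^ K), inferInstance, inferInstance, n, A, B, C, hS, ?_⟩
  rw [ZMod.card, Nat.cast_pow]
  exact hbeat

/-- Registered stub `stub_cruxGivesCThesis` of crux stmt-MatrixMultiplication-7356 (line `Sketch`,
stub 16: the crux implies X_C of route `GroupTheoreticSTPP`) — verbatim
`cThesis_of_automaticPackingThesis`. [cite: CohnKleinbergSzegedyUmans2005, Def. 5.1] -/
theorem stub_cruxGivesCThesis :
    AutomaticPackingThesis →
      Summit.MatrixMultiplication.MatrixMultiplication.Theses.GroupTheoreticSTPP.CThesis :=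
  cThesis_of_automaticPackingThesis

/-- **The route's abelian negative refutes the crux.** If some uniform `ε > 0` bars every STPP
family in every finite abelian group from beating its host at exponent `(2+ε)/3`
(`CAbelianObstructionNeg`, stmt-MatrixMultiplication-0596), then `AutomaticPackingThesis` fails:
its `CThesis` witness at that `ε` (`cThesis_of_automaticPackingThesis`) would beat its host.
[folklore] -/
theorem not_automaticPackingThesis_of_cAbelianObstructionNeg :
    Summit.MatrixMultiplication.MatrixMultiplication.Theses.GroupTheoreticSTPP.CAbelianObstructionNeg →
      ¬ AutomaticPackingThesis := by
  rintro ⟨ε, hε, hall⟩ h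
  obtain ⟨H, i1, i2, N, A, B, C, hS, hlt⟩ := cThesis_of_automaticPackingThesis h ε hε
  exact absurd (hlt.trans_le (@hall H i1 i2 N A B C hS)) (lt_irrefl _)

end AutomaticPackingThesis

end Summit.MatrixMultiplication.MatrixMultiplication.Theorems

end
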